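import Summits.ResolutionOfSingularities.ResolutionOfSingularities.Theorems.HilbertSamuelEliminationSigmaMaxModificationsCorridor3SigmaPersistentContactCover
import Literature.AlgebraicGeometry.Resolution.IdealSheafLemmas
import Literature.AlgebraicGeometry.Resolution.DiffIdealSheafOpenImmersion
import Mathlib.Topology.JacobsonSpace
import HarnessLib

/-!
# [OURS · L1 W4.2] σ-LAYER — `Corridor3SigmaPersistentContactCoverExists`: THE INSTANCE of the (T-adapt)/(G-glob) socket — a persistent contact cover EXISTS at
# instance start: `Z` smooth and quasi-compact over a PERFECT field of characteristic `p`, `p ∤ S₀`, every point of `N`-order `≤ S₀` and the `S₀`-fold locus closed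
# ⇒ `ContactCover.ExistsAtStart (overHom K Z) N S₀` — PROVED: res-D-pv-060's T-L1 `exists_diffContactChart_of_not_dvd` (p557013) at every CLOSED point of the locus,
# the principal ideal sheaf of the delivered section on the affine open subscheme (`ContactChart.ofSection`), Jacobson density of closed points
# (`nonempty_inter_closedPoints`) and compactness of the closed locus (`IsCompact.elim_finite_subcover`)
# (crux chain w42 `SigmaMaxModifications` stmt-ResolutionOfSingularities-18506 / conjunct `SigmaMaxModificationsCorridor3` stmt-ResolutionOfSingularities-19249;
# res-L1-w42-plan-1 RULING v3.14-51 (51C) «finite affine cover of X_max at instance start by diff-contact charts — T-L1 pointwise + quasi-compactness»; the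
# companion `…Corridor3SigmaPersistentContactCover` (p568042) has the structures and the TRANSPORT; seat res-L1-type-o2 g9 = «res-type-067/068 SUCCESSOR»;
# `--supports stmt-ResolutionOfSingularities-19249 --as helper`, counted 0)

HONEST FRAMING. OURS packaging; every `theorem` PROVED, one `def` (`ContactChart.ofSection`); no named fact, no axiom, no instance, no notation. The mathematics is
060's T-L1 existence (Hasse–Schmidt linear part at a closed point of a smooth scheme over a perfect field) plus Mathlib topology (Jacobson spaces, compactness) and
the tree's `Diff^{≤n}`-restriction lemma (`comap_diffIdealSheaf_of_isOpenImmersion`, EGA IV₄ 16.8). NOTHING here is a statement of H. Hironaka's manuscript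
[Hironaka2017] nor of Cutkosky 2009 / Cossart–Jannsen–Saito. BINDERS kept honest: `PerfectField K` and `Smooth` are T-L1's (DESK NOTE BD-1: inseparable-residue
closed points are a scope limit, `tameLowInsep`); «`∀ y, ord_y N ≤ S₀`» is tri-1's precondition 2026-08-27T20:28:34Z; closedness of the locus is the tree's upper
semicontinuity (`isClosed_setOf_le_idealOrder` / `support_diffIdealSheaf_eq_setOf_le_idealOrder`), taken as a hypothesis. AI-typed; AI review weaker than expert review.

## Contents (namespace `…Theorems.SigmaMaxModificationsCorridor3.Sigma`)

* §5 THE CHART FROM A SECTION (affine open `U ⊆ X`, `z ∈ Γ(X, U)`; the principal ideal sheaf `ofIdealTop (span {z|_U})` on `↑U`): `topIso_inv_eq_map`,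
  `ofIdealTop_span_le_comap` (`z ∈ I(U) ⇒ (z) ≤ I|_U`, via Mathlib `ideal_comap_of_isOpenImmersion` + `Scheme.Opens.ι_appIso = refl` + `map_ideal`),
  `mem_support_ofIdealTop_span_iff` (`V((z)) = V(z)` read on `X`, `Scheme.Opens.ι_image_basicOpen_topIso_inv`), `stalkIdeal_ofIdealTop_span` (the stalk ideal
  is principal on the germ, `stalkIdeal_eq_map_germ`), `stalkIso_hom_germ_topIso_inv` / `germ_topIso_inv_not_mem_sq` (order one transports along
  `Scheme.Opens.stalkIso`, `map_ringEquiv_maximalIdeal`), and **`ContactChart.ofSection`** (+ `ofSection_U`).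
* §6 EXISTENCE: `hasFiniteTypeSections_ι_comp_overHom` (restricted `K`-structure of an open has finite-type sections), **`exists_contactChart_mem`** (a chart at
  a closed point of the locus), **`exists_contactCover : … → ContactCover.ExistsAtStart (overHom K Z) N S₀`**.
-/

noncomputable section

set_option linter.dupNamespace false -- mandated namespace of this single-conjunct summit

open CategoryTheory AlgebraicGeometry TopologicalSpace IsLocalRing
open Literature.AlgebraicGeometry.Resolution
open Summit.ResolutionOfSingularities.ResolutionOfSingularities.Theorems.SigmaMaxModificationsCorridor3.Helpers

namespace Summit.ResolutionOfSingularities.ResolutionOfSingularities.Theorems.SigmaMaxModificationsCorridor3.Sigma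

universe u v

open Opposite

/-! ## §5. A chart from a section (the shape T-L1's existence theorem delivers) -/

section OfSection

variable {X : Scheme.{u}} (U : X.affineOpens)

/-- The restriction of a section of `U` to the top of the open subscheme `↑U` is a restriction map of `X`. [folklore] -/
theorem topIso_inv_eq_map (z : Γ(X, U)) :
    ∃ h : op (U : X.Opens) ⟶ op (U.1.ι ''ᵁ ⊤), U.1.topIso.inv z = (X.presheaf.map h).hom z := by
  refine ⟨(homOfLE U.1.ι_image_top.le).op, ?_⟩
  rw [Scheme.Opens.topIso_inv]
  congr 2

/-- **The principal ideal sheaf of a section of `I(U)` lies in `I|_U`** (on the affine open subscheme `↑U`). [folklore] -/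
theorem ofIdealTop_span_le_comap (I : X.IdealSheafData) (z : Γ(X, U)) (hz : z ∈ I.ideal U) :
    Scheme.IdealSheafData.ofIdealTop (Ideal.span {U.1.topIso.inv z}) ≤ I.comap U.1.ι := by
  haveI : IsAffine (U.1 : Scheme.{u}) := U.2
  apply Scheme.IdealSheafData.le_of_isAffine
  rw [ideal_ofIdealTop_top, Ideal.span_le, Set.singleton_subset_iff, SetLike.mem_coe,
    Scheme.IdealSheafData.ideal_comap_of_isOpenImmersion, Scheme.Opens.ι_appIso, Iso.refl_inv]
  let V : X.affineOpens := ⟨U.1.ι ''ᵁ ⊤, (isAffineOpen_top (U.1 : Scheme.{u})).image_of_isOpenImmersion U.1.ι⟩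
  have hVU : V ≤ U := U.1.ι_image_top.le
  change U.1.topIso.inv z ∈ (I.ideal V).comap (𝟙 _ : Γ(X, V) ⟶ Γ(X, V)).hom
  rw [CommRingCat.hom_id, Ideal.comap_id, ← I.map_ideal hVU]
  obtain ⟨h, hh⟩ := topIso_inv_eq_map U z
  have : h = (homOfLE hVU).op := Subsingleton.elim _ _
  rw [hh, this]
  exact Ideal.mem_map_of_mem _ hz

/-- **Support of the principal ideal sheaf = the zero locus of the section**, read on `X`. [folklore] -/
theorem mem_support_ofIdealTop_span_iff (z : Γ(X, U)) (x : (U.1 : Scheme.{u})) :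
    x ∈ ((Scheme.IdealSheafData.ofIdealTop (Ideal.span {U.1.topIso.inv z})).support : Set (U.1 : Scheme.{u})) ↔
      U.1.ι x ∈ X.zeroLocus (U := U) {z} := by
  rw [Scheme.IdealSheafData.coe_support_ofIdealTop, Scheme.zeroLocus_span, Scheme.mem_zeroLocus_iff, Scheme.mem_zeroLocus_iff]
  simp only [Set.mem_singleton_iff, forall_eq]
  conv_rhs => rw [← Scheme.Opens.ι_image_basicOpen_topIso_inv U.1 z, Scheme.Opens.ι_apply, Scheme.Opens.mem_ι_image_iff]
  exact Iff.rfl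

/-- **The stalk ideal of the principal ideal sheaf is principal**, generated by the germ of the section. [folklore] -/
theorem stalkIdeal_ofIdealTop_span (z' : Γ((U.1 : Scheme.{u}), ⊤)) (x : (U.1 : Scheme.{u})) :
    stalkIdeal (Scheme.IdealSheafData.ofIdealTop (Ideal.span {z'})) x =
      Ideal.span {((U.1 : Scheme.{u}).presheaf.germ ⊤ x trivial).hom z'} := by
  haveI : IsAffine (U.1 : Scheme.{u}) := U.2
  rw [stalkIdeal_eq_map_germ _ ⟨⊤, isAffineOpen_top _⟩ trivial, ideal_ofIdealTop_top, Ideal.map_span, Set.image_singleton]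

/-- The germ of the restricted section, transported to `X` along the stalk isomorphism of the open subscheme, is the germ of the section. [folklore] -/
theorem stalkIso_hom_germ_topIso_inv (z : Γ(X, U)) (x : (U.1 : Scheme.{u})) :
    (U.1.stalkIso x).hom.hom (((U.1 : Scheme.{u}).presheaf.germ ⊤ x trivial).hom (U.1.topIso.inv z)) =
      (X.presheaf.germ U x.1 x.2).hom z := by
  obtain ⟨h, hh⟩ := topIso_inv_eq_map U z
  rw [hh, ← CommRingCat.comp_apply, Scheme.Opens.germ_stalkIso_hom]
  exact TopCat.Presheaf.germ_res_apply X.presheaf h.unop x.1 _ z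

/-- **Order one transports**: if the germ of `z` at `x` is not in `𝔪_x²` on `X`, the germ of the restricted section is not in `𝔪_x²` on `↑U`. [folklore] -/
theorem germ_topIso_inv_not_mem_sq (z : Γ(X, U)) (x : (U.1 : Scheme.{u}))
    (hz : (X.presheaf.germ U x.1 x.2).hom z ∉ maximalIdeal (X.presheaf.stalk x.1) ^ 2) :
    ((U.1 : Scheme.{u}).presheaf.germ ⊤ x trivial).hom (U.1.topIso.inv z) ∉ maximalIdeal ((U.1 : Scheme.{u}).presheaf.stalk x) ^ 2 := by
  intro hmem
  apply hz
  rw [← stalkIso_hom_germ_topIso_inv]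
  let e : (U.1 : Scheme.{u}).presheaf.stalk x ≃+* X.presheaf.stalk x.1 := (U.1.stalkIso x).commRingCatIsoToRingEquiv
  have he : ∀ v, (U.1.stalkIso x).hom.hom v = e v := fun v => rfl
  rw [he, ← IsLocalRing.map_ringEquiv_maximalIdeal e, ← Ideal.map_pow]
  exact Ideal.mem_map_of_mem _ hmem

variable {K : Type v} [Field K] {φ : K →+* Γ(X, ⊤)}

/-- [OURS · L1 W4.2] **A CONTACT CHART FROM A SECTION** — the shape T-L1's `exists_diffContactChart_of_not_dvd` delivers: an affine open `U`, a section
`z ∈ Diff^{≤S₀−1}(N)(U)` of order `≤ 1` at every point of `U`, with `Sing_{S₀}(N) ∩ U ⊆ V(z)`; the chart's contact ideal sheaf is the principal ideal sheaf of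
`z` on `↑U`. [folklore] -/
def ContactChart.ofSection (hφ : HasFiniteTypeSections φ) (N : X.IdealSheafData) (S₀ : ℕ) (hU : HasFiniteTypeSections (U.1.ι.appTop.hom.comp φ))
    (z : Γ(X, U)) (hzD : z ∈ (diffIdealSheaf φ (S₀ - 1) N).ideal U)
    (hz1 : ∀ (y : X) (hy : y ∈ (U : X.Opens)), (X.presheaf.germ U y hy).hom z ∉ maximalIdeal (X.presheaf.stalk y) ^ 2)
    (hsing : {y : X | (S₀ : ℕ∞) ≤ idealOrder N y} ∩ (U : Set X) ⊆ X.zeroLocus (U := U) {z}) : ContactChart φ N S₀ where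
  U := U.1
  H := Scheme.IdealSheafData.ofIdealTop (Ideal.span {U.1.topIso.inv z})
  le_diff := by
    rw [← comap_diffIdealSheaf_of_isOpenImmersion U.1.ι φ hφ hU]
    exact ofIdealTop_span_le_comap U _ z hzD
  order_one x _ := ⟨_, stalkIdeal_ofIdealTop_span U _ x, germ_topIso_inv_not_mem_sq U z x (hz1 x.1 x.2)⟩
  sing_subset x hx := by
    refine (mem_support_ofIdealTop_span_iff U z x).mpr (hsing ⟨?_, x.2⟩)
    rw [Set.mem_setOf_eq, ← idealOrder_comap_of_isOpenImmersion U.1.ι]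
    exact hx

/-- The chart's open is `U`. [folklore] -/
theorem ContactChart.ofSection_U (hφ : HasFiniteTypeSections φ) (N : X.IdealSheafData) (S₀ : ℕ) (hU : HasFiniteTypeSections (U.1.ι.appTop.hom.comp φ))
    (z : Γ(X, U)) (hzD : z ∈ (diffIdealSheaf φ (S₀ - 1) N).ideal U)
    (hz1 : ∀ (y : X) (hy : y ∈ (U : X.Opens)), (X.presheaf.germ U y hy).hom z ∉ maximalIdeal (X.presheaf.stalk y) ^ 2)
    (hsing : {y : X | (S₀ : ℕ∞) ≤ idealOrder N y} ∩ (U : Set X) ⊆ X.zeroLocus (U := U) {z}) :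
    (ContactChart.ofSection U hφ N S₀ hU z hzD hz1 hsing).U = U.1 := rfl

end OfSection

/-! ## §6. EXISTENCE of a persistent contact cover at instance start (T-L1 at closed points + Jacobson + quasi-compactness) -/

section Existence

variable (K : Type u) [Field K] (p : ℕ) (Z : Scheme.{u}) [Z.Over (Spec (.of K))]

/-- The restricted `K`-structure on an open of a scheme locally of finite type over `K` has finite-type sections. [folklore] -/
theorem hasFiniteTypeSections_ι_comp_overHom [LocallyOfFiniteType (Z ↘ Spec (.of K))] (U : Z.Opens) :
    HasFiniteTypeSections (U.ι.appTop.hom.comp (overHom K Z)) := by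
  have h := hasFiniteTypeSections_of_locallyOfFiniteType K (U.ι ≫ (Z ↘ Spec (.of K)))
  have heq : (U.ι ≫ (Z ↘ Spec (.of K))).appTop.hom.comp (Scheme.ΓSpecIso (.of K)).inv.hom = U.ι.appTop.hom.comp (overHom K Z) := by
    unfold overHom
    rw [Scheme.Hom.comp_appTop, CommRingCat.hom_comp, RingHom.comp_assoc]
  rw [← heq]
  exact h

variable [PerfectField K] [CharP K p] [Smooth (Z ↘ Spec (.of K))]

/-- **A contact chart AT a closed point of the `S₀`-fold locus** (T-L1 `exists_diffContactChart_of_not_dvd` + `ContactChart.ofSection`; the order at the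
point is exactly `S₀` by the row's maximality `hmax`). [folklore] -/
theorem exists_contactChart_mem (N : Z.IdealSheafData) {S₀ : ℕ} (hS : 1 ≤ S₀) (hp : ¬ p ∣ S₀) (hmax : ∀ y : Z, idealOrder N y ≤ S₀)
    {ξ : Z} (hξ : IsClosed ({ξ} : Set Z)) (hξL : (S₀ : ℕ∞) ≤ idealOrder N ξ) :
    ∃ ch : ContactChart (overHom K Z) N S₀, ξ ∈ (ch.U : Set Z) := by
  have hord : idealOrder N ξ = S₀ := le_antisymm (hmax ξ) hξL
  obtain ⟨U, hξU, z, hzD, -, hz1, -, hsing⟩ := Helpers.exists_diffContactChart_of_not_dvd K Z p N hS hp hξ hord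
  have hφ : HasFiniteTypeSections (overHom K Z) := hasFiniteTypeSections_of_locallyOfFiniteType K (Z ↘ Spec (.of K))
  exact ⟨ContactChart.ofSection U hφ N S₀ (hasFiniteTypeSections_ι_comp_overHom K Z U.1) z hzD hz1 hsing, hξU⟩

/-- [OURS · L1 W4.2] **EXISTENCE OF A PERSISTENT CONTACT COVER AT INSTANCE START**: `Z` smooth and quasi-compact over a PERFECT field `K` of characteristic
`p`, `p ∤ S₀`, `1 ≤ S₀`, every point of order `≤ S₀` (the tame row's maximality — tri-1's precondition «`∀ y, ord_y N ≤ S₀`») and the `S₀`-fold locus closed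
(upper semicontinuity, tree `isClosed_setOf_le_idealOrder` / `support_diffIdealSheaf_eq_setOf_le_idealOrder`) ⇒ finitely many diff-contact charts cover the
locus: T-L1 at every CLOSED point of the locus, the closed points are dense in the locally closed remainder (Jacobson, `nonempty_inter_closedPoints`), and the
closed locus is compact. The INSTANCE of `ContactCover.ExistsAtStart`. [folklore] -/
theorem exists_contactCover [CompactSpace Z] [JacobsonSpace Z] (N : Z.IdealSheafData) {S₀ : ℕ} (hS : 1 ≤ S₀) (hp : ¬ p ∣ S₀)
    (hmax : ∀ y : Z, idealOrder N y ≤ S₀) (hclosed : IsClosed {y : Z | (S₀ : ℕ∞) ≤ idealOrder N y}) :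
    ContactCover.ExistsAtStart (overHom K Z) N S₀ := by
  classical
  set L : Set Z := {y : Z | (S₀ : ℕ∞) ≤ idealOrder N y} with hL
  let P : Type u := {ξ : Z // ξ ∈ L ∧ IsClosed ({ξ} : Set Z)}
  have hch : ∀ ξ : P, ∃ ch : ContactChart (overHom K Z) N S₀, (ξ : Z) ∈ (ch.U : Set Z) :=
    fun ξ => exists_contactChart_mem K p Z N hS hp hmax ξ.2.2 ξ.2.1
  choose ch hch using hch
  -- the opens cover `L` (Jacobson: a non-empty locally closed set has a closed point)
  have hcov : L ⊆ ⋃ ξ : P, ((ch ξ).U : Set Z) := by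
    intro y hy
    by_contra hyU
    have hne : (L ∩ (⋃ ξ : P, ((ch ξ).U : Set Z))ᶜ).Nonempty := ⟨y, hy, hyU⟩
    have hlc : IsLocallyClosed (L ∩ (⋃ ξ : P, ((ch ξ).U : Set Z))ᶜ) :=
      (hclosed.inter (isOpen_iUnion fun ξ => (ch ξ).U.2).isClosed_compl).isLocallyClosed
    obtain ⟨ξ₀, ⟨hξ₀L, hξ₀U⟩, hξ₀cl⟩ := nonempty_inter_closedPoints hne hlc
    exact hξ₀U (Set.mem_iUnion.mpr ⟨⟨ξ₀, hξ₀L, hξ₀cl⟩, hch _⟩)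
  -- finite subcover (the closed locus is compact)
  obtain ⟨t, ht⟩ := hclosed.isCompact.elim_finite_subcover (fun ξ : P => ((ch ξ).U : Set Z)) (fun ξ => (ch ξ).U.2) hcov
  let l := t.toList
  refine ⟨{ n := l.length, chart := fun i => ch (l.get i), covers := ?_ }⟩
  intro y hy
  have hy' : y ∈ ⋃ ξ ∈ t, ((ch ξ).U : Set Z) := ht hy
  simp only [Set.mem_iUnion, exists_prop] at hy'
  obtain ⟨ξ, hξt, hyξ⟩ := hy'
  obtain ⟨i, hi⟩ := List.mem_iff_get.mp (Finset.mem_toList.mpr hξt)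
  exact Set.mem_iUnion.mpr ⟨i, by rw [hi]; exact hyξ⟩

end Existence

end Summit.ResolutionOfSingularities.ResolutionOfSingularities.Theorems.SigmaMaxModificationsCorridor3.Sigma

end
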